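import Summits.QuantumFields.YangMills.Theses.FradkinShenkerFlow
import Literature.MathematicalPhysics.QuantumFieldTheory.LatticeGaugeProofs
import Literature.MathematicalPhysics.QuantumLattice.TorusWilsonGibbs

/-!
# `SusceptibilityToPoincare` — negative side: exchangeability (DLR consistency) of the one-link heat bath

Support file for crux `stmt-QuantumFields-9441`
(`Summit.QuantumFields.YangMills.Theses.FradkinShenkerFlow.SusceptibilityToPoincare`, FS ⇒ UP), from the standing
disprover's work file `Cruxes/SusceptibilityToPoincare/Disproof.lean` §2b (cycle 1): the measure-theoretic facts about the
crux's one-link heat-bath law `ν_ℓ^U = Haar.tilted(−β S_W(U[ℓ ↦ ·]))` that every flux estimate uses.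

* `lintegral_heatBath_update` — **DLR consistency / exchangeability**: for measurable `ψ ≥ 0`,
  `∫ (∫ ψ(U[ℓ ↦ g]) dν_ℓ^U(g)) dμ_{β,S}(U) = ∫ ψ dμ_{β,S}` (integrate the coordinate `ℓ` of the product Haar measure first —
  Mathlib `lmarginal`; the one-link normaliser cancels);
* `measurable_lintegral_heatBath`, `measurable_lintegral_heatBath_update` — measurability in `U` of heat-bath expectations of
  jointly measurable integrands (the kernel is a jointly measurable density against Haar; `G` is second countable through `r`,
  `secondCountableTopology_of_latticeRep`);
* `isProbabilityMeasure_heatBath` — the heat-bath law is a probability measure.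
Every compact `G`, every lattice representation `r`, every real `β`; nothing here asserts a Theses statement.
-/

noncomputable section

namespace Summit.QuantumFields.YangMills.Theorems.SusceptibilityToPoincare.Negative

open MeasureTheory ProbabilityTheory Filter Topology Function
open scoped ENNReal
open Literature.MathematicalPhysics.QuantumFieldTheory
open Literature.MathematicalPhysics.QuantumLattice (wilsonMeasure_eq_tilted_pi)

variable {G : Type} [Group G] [TopologicalSpace G] [IsTopologicalGroup G] [CompactSpace G]
  [MeasurableSpace G] [BorelSpace G]

omit [IsTopologicalGroup G] [MeasurableSpace G] [BorelSpace G] in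
/-- A group with a faithful finite-dimensional continuous representation is second countable. [folklore] -/
theorem secondCountableTopology_of_latticeRep (r : LatticeRep G) : SecondCountableTopology G :=
  (r.continuous.isClosedEmbedding r.injective).isEmbedding.secondCountableTopology

/-- **DLR consistency / exchangeability of the one-link heat bath** (extended non-negative form): resampling the
link `ℓ` from its heat-bath law `ν_ℓ^U = Haar.tilted(−β S_W(U[ℓ ↦ ·]))` leaves the torus Wilson measure invariant,
`∫ (∫ ψ(U[ℓ ↦ g]) dν_ℓ^U(g)) dμ_{β,S}(U) = ∫ ψ dμ_{β,S}` for every measurable `ψ ≥ 0`. Every compact `G`, real `β`. [folklore] -/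
theorem lintegral_heatBath_update (r : LatticeRep G) (β : ℝ) (S : ℕ) (ℓ : Edge 4 (2 * S + 1))
    {ψ : GaugeConfig 4 (2 * S + 1) G → ℝ≥0∞} (hψ : Measurable ψ) :
    ∫⁻ U, ∫⁻ g, ψ (update U ℓ g)
        ∂((haarProbability G).tilted (fun g' => -β * wilsonAction r.ρ (update U ℓ g')))
        ∂(wilsonMeasure (d := 4) (L := 2 * S + 1) r.ρ β) =
      ∫⁻ U, ψ U ∂(wilsonMeasure (d := 4) (L := 2 * S + 1) r.ρ β) := by
  haveI : SecondCountableTopology G := secondCountableTopology_of_latticeRep r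
  classical
  -- notation
  set π : Measure (GaugeConfig 4 (2 * S + 1) G) := Measure.pi fun _ : Edge 4 (2 * S + 1) => haarProbability G
    with hπ
  set w : GaugeConfig 4 (2 * S + 1) G → ℝ := fun U => Real.exp (-β * wilsonAction r.ρ U) with hw
  have hw_meas : Measurable w := ((measurable_wilsonAction r.ρ r.continuous).const_mul _).exp
  have hw_pos : ∀ U, 0 < w U := fun U => Real.exp_pos _
  obtain ⟨B, hB⟩ := exists_abs_wilsonAction_le (d := 4) (L := 2 * S + 1) r.ρ r.continuous
  have hw_le : ∀ U, w U ≤ Real.exp (|β| * B) := fun U => by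
    refine Real.exp_le_exp.2 ?_
    have h : |β * wilsonAction r.ρ U| ≤ |β| * B := by
      rw [abs_mul]; exact mul_le_mul_of_nonneg_left (hB U) (abs_nonneg _)
    have := (abs_le.1 h).1
    linarith
  have hw_norm : ∀ U, ‖w U‖ ≤ Real.exp (|β| * B) := fun U => by
    rw [Real.norm_eq_abs, abs_of_pos (hw_pos U)]; exact hw_le U
  -- the one-link normaliser `c U = ∫ w(U[ℓ ↦ g]) dHaar(g)`
  set c : GaugeConfig 4 (2 * S + 1) G → ℝ := fun U => ∫ g, w (update U ℓ g) ∂haarProbability G with hc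
  have hwu_meas : ∀ U, Measurable fun g : G => w (update U ℓ g) := fun U =>
    hw_meas.comp (measurable_update U)
  have hwu_int : ∀ U, Integrable (fun g : G => w (update U ℓ g)) (haarProbability G) := fun U =>
    Integrable.of_bound (hwu_meas U).aestronglyMeasurable _ (ae_of_all _ fun g => hw_norm _)
  have hc_pos : ∀ U, 0 < c U := fun U => integral_exp_pos (hwu_int U)
  have hc_update : ∀ U u, c (update U ℓ u) = c U := fun U u => by
    simp only [hc, update_idem]
  -- joint measurability of `(U, g) ↦ w (U[ℓ ↦ g])` and measurability of `c`
  have hwj : Measurable fun p : GaugeConfig 4 (2 * S + 1) G × G => w (update p.1 ℓ p.2) :=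
    hw_meas.comp measurable_update'
  have hc_meas : Measurable c :=
    (hwj.stronglyMeasurable.integral_prod_right' (ν := haarProbability G)).measurable
  -- the Wilson measure as a density w.r.t. `π`
  set Z : ℝ := ∫ U, w U ∂π with hZ
  have hw_int : Integrable w π := Integrable.of_bound hw_meas.aestronglyMeasurable _ (ae_of_all _ hw_norm)
  have hZ_pos : 0 < Z := integral_exp_pos hw_int
  have hμ : wilsonMeasure (d := 4) (L := 2 * S + 1) r.ρ β =
      π.withDensity (fun U => ENNReal.ofReal (w U / Z)) := by
    rw [wilsonMeasure_eq_tilted_pi r.ρ r.continuous β]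
    rfl
  -- the heat-bath kernel as a density w.r.t. Haar
  have hν : ∀ U : GaugeConfig 4 (2 * S + 1) G,
      (haarProbability G).tilted (fun g' => -β * wilsonAction r.ρ (update U ℓ g')) =
        (haarProbability G).withDensity (fun g => ENNReal.ofReal (w (update U ℓ g) / c U)) :=
    fun U => rfl
  have hdμ_meas : Measurable fun U => ENNReal.ofReal (w U / Z) := (hw_meas.div_const Z).ennreal_ofReal
  have hdν_meas : ∀ U, Measurable fun g : G => ENNReal.ofReal (w (update U ℓ g) / c U) := fun U =>
    ((hwu_meas U).div_const _).ennreal_ofReal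
  -- joint measurability of the inner integrand and measurability of the inner integral
  have hΦj : Measurable fun p : GaugeConfig 4 (2 * S + 1) G × G =>
      ENNReal.ofReal (w (update p.1 ℓ p.2) / c p.1) * ψ (update p.1 ℓ p.2) :=
    ((hwj.div (hc_meas.comp measurable_fst)).ennreal_ofReal).mul (hψ.comp measurable_update')
  have hΦ_meas : Measurable fun U : GaugeConfig 4 (2 * S + 1) G =>
      ∫⁻ g, ENNReal.ofReal (w (update U ℓ g) / c U) * ψ (update U ℓ g) ∂haarProbability G :=
    hΦj.lintegral_prod_right'
  -- rewrite the inner integrals against Haar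
  have hinner : ∀ U : GaugeConfig 4 (2 * S + 1) G,
      ∫⁻ g, ψ (update U ℓ g) ∂((haarProbability G).tilted (fun g' => -β * wilsonAction r.ρ (update U ℓ g'))) =
        ∫⁻ g, ENNReal.ofReal (w (update U ℓ g) / c U) * ψ (update U ℓ g) ∂haarProbability G := fun U => by
    have hm : Measurable fun g : G => ψ (update U ℓ g) := hψ.comp (measurable_update U)
    rw [hν U, lintegral_withDensity_eq_lintegral_mul _ (hdν_meas U) hm]
    rfl
  simp_rw [hinner]
  rw [hμ, lintegral_withDensity_eq_lintegral_mul _ hdμ_meas hΦ_meas,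
    lintegral_withDensity_eq_lintegral_mul _ hdμ_meas hψ]
  -- integrate out the coordinate `ℓ` first on both sides
  refine lintegral_eq_of_lmarginal_eq {ℓ} (hdμ_meas.mul hΦ_meas) (hdμ_meas.mul hψ) ?_
  rw [lmarginal_singleton, lmarginal_singleton]
  funext x
  have hdivZ : ∀ a : ℝ, ENNReal.ofReal (a / Z) = (ENNReal.ofReal Z)⁻¹ * ENNReal.ofReal a := fun a => by
    rw [ENNReal.ofReal_div_of_pos hZ_pos, div_eq_mul_inv, mul_comm]
  have hdivc : ∀ a : ℝ, ENNReal.ofReal (a / c x) = (ENNReal.ofReal (c x))⁻¹ * ENNReal.ofReal a := fun a => by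
    rw [ENNReal.ofReal_div_of_pos (hc_pos x), div_eq_mul_inv, mul_comm]
  have hcx0 : ENNReal.ofReal (c x) ≠ 0 := (ENNReal.ofReal_pos.2 (hc_pos x)).ne'
  have hcxT : ENNReal.ofReal (c x) ≠ ∞ := ENNReal.ofReal_ne_top
  -- `∫ ofReal (w (x[ℓ ↦ u])) dHaar(u) = ofReal (c x)`
  have hA : ∫⁻ u, ENNReal.ofReal (w (update x ℓ u)) ∂haarProbability G = ENNReal.ofReal (c x) :=
    (ofReal_integral_eq_lintegral_ofReal (hwu_int x) (ae_of_all _ fun g => (hw_pos _).le)).symm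
  have hJ_meas : Measurable fun g : G => ENNReal.ofReal (w (update x ℓ g)) * ψ (update x ℓ g) :=
    (hwu_meas x).ennreal_ofReal.mul (hψ.comp (measurable_update x))
  simp only [Pi.mul_apply, update_idem, hc_update, hdivZ, hdivc]
  -- left: (∫ (Z⁻¹ w) dHaar) * ((c x)⁻¹ * J) ; right: Z⁻¹ * J
  simp_rw [mul_assoc]
  rw [lintegral_const_mul _ ((hwu_meas x).ennreal_ofReal.mul_const _),
    lintegral_mul_const _ (hwu_meas x).ennreal_ofReal, hA,
    lintegral_const_mul _ hJ_meas, lintegral_const_mul _ hJ_meas]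
  rw [← mul_assoc (ENNReal.ofReal (c x)), ENNReal.mul_inv_cancel hcx0 hcxT, one_mul]

/-- Measurability in the configuration of one-link heat-bath expectations `U ↦ ∫ K(U, g) dν_ℓ^U(g)` for jointly
measurable `K ≥ 0` (the kernel is a jointly measurable density against Haar; `G` is second countable through `r`).
[folklore] -/
theorem measurable_lintegral_heatBath (r : LatticeRep G) (β : ℝ) (S : ℕ) (ℓ : Edge 4 (2 * S + 1))
    {K : GaugeConfig 4 (2 * S + 1) G × G → ℝ≥0∞} (hK : Measurable K) :
    Measurable fun U : GaugeConfig 4 (2 * S + 1) G => ∫⁻ g, K (U, g)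
      ∂((haarProbability G).tilted (fun g' => -β * wilsonAction r.ρ (update U ℓ g'))) := by
  haveI : SecondCountableTopology G := secondCountableTopology_of_latticeRep r
  set w : GaugeConfig 4 (2 * S + 1) G → ℝ := fun U => Real.exp (-β * wilsonAction r.ρ U) with hw
  have hw_meas : Measurable w := ((measurable_wilsonAction r.ρ r.continuous).const_mul _).exp
  set c : GaugeConfig 4 (2 * S + 1) G → ℝ := fun U => ∫ g, w (update U ℓ g) ∂haarProbability G with hc
  have hwj : Measurable fun p : GaugeConfig 4 (2 * S + 1) G × G => w (update p.1 ℓ p.2) :=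
    hw_meas.comp measurable_update'
  have hc_meas : Measurable c :=
    (hwj.stronglyMeasurable.integral_prod_right' (ν := haarProbability G)).measurable
  have hν : ∀ U : GaugeConfig 4 (2 * S + 1) G,
      (haarProbability G).tilted (fun g' => -β * wilsonAction r.ρ (update U ℓ g')) =
        (haarProbability G).withDensity (fun g => ENNReal.ofReal (w (update U ℓ g) / c U)) :=
    fun U => rfl
  have hdν_meas : ∀ U, Measurable fun g : G => ENNReal.ofReal (w (update U ℓ g) / c U) := fun U =>
    ((hw_meas.comp (measurable_update U)).div_const _).ennreal_ofReal
  have hΦj : Measurable fun p : GaugeConfig 4 (2 * S + 1) G × G =>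
      ENNReal.ofReal (w (update p.1 ℓ p.2) / c p.1) * K p :=
    ((hwj.div (hc_meas.comp measurable_fst)).ennreal_ofReal).mul hK
  have hinner : ∀ U : GaugeConfig 4 (2 * S + 1) G,
      ∫⁻ g, K (U, g) ∂((haarProbability G).tilted (fun g' => -β * wilsonAction r.ρ (update U ℓ g'))) =
        ∫⁻ g, ENNReal.ofReal (w (update U ℓ g) / c U) * K (U, g) ∂haarProbability G := fun U => by
    have hm : Measurable fun g : G => K (U, g) := hK.comp measurable_prodMk_left
    rw [hν U, lintegral_withDensity_eq_lintegral_mul _ (hdν_meas U) hm]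
    rfl
  simp_rw [hinner]
  exact hΦj.lintegral_prod_right'

/-- Measurability of `U ↦ ∫ ψ(U[ℓ ↦ g]) dν_ℓ^U(g)` for measurable `ψ ≥ 0`. [folklore] -/
theorem measurable_lintegral_heatBath_update (r : LatticeRep G) (β : ℝ) (S : ℕ) (ℓ : Edge 4 (2 * S + 1))
    {ψ : GaugeConfig 4 (2 * S + 1) G → ℝ≥0∞} (hψ : Measurable ψ) :
    Measurable fun U : GaugeConfig 4 (2 * S + 1) G => ∫⁻ g, ψ (update U ℓ g)
      ∂((haarProbability G).tilted (fun g' => -β * wilsonAction r.ρ (update U ℓ g'))) :=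
  measurable_lintegral_heatBath r β S ℓ (K := fun p => ψ (update p.1 ℓ p.2)) (hψ.comp measurable_update')

/-- The one-link heat-bath law is a probability measure. [folklore] -/
theorem isProbabilityMeasure_heatBath (r : LatticeRep G) (β : ℝ) (S : ℕ) (ℓ : Edge 4 (2 * S + 1))
    (U : GaugeConfig 4 (2 * S + 1) G) :
    IsProbabilityMeasure ((haarProbability G).tilted (fun g' => -β * wilsonAction r.ρ (update U ℓ g'))) := by
  haveI : SecondCountableTopology G := secondCountableTopology_of_latticeRep r
  refine isProbabilityMeasure_tilted ?_
  obtain ⟨B, hB⟩ := exists_abs_wilsonAction_le (d := 4) (L := 2 * S + 1) r.ρ r.continuous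
  have hmeas : Measurable fun g : G => Real.exp (-β * wilsonAction r.ρ (update U ℓ g)) :=
    (((measurable_wilsonAction r.ρ r.continuous).comp (measurable_update U)).const_mul _).exp
  refine Integrable.of_bound hmeas.aestronglyMeasurable (Real.exp (|β| * B)) (ae_of_all _ fun g => ?_)
  rw [Real.norm_eq_abs, Real.abs_exp, Real.exp_le_exp]
  have h : |β * wilsonAction r.ρ (update U ℓ g)| ≤ |β| * B := by
    rw [abs_mul]; exact mul_le_mul_of_nonneg_left (hB _) (abs_nonneg _)
  have := (abs_le.1 h).1
  linarith

end Summit.QuantumFields.YangMills.Theorems.SusceptibilityToPoincare.Negative
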